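import Literature.NumberTheory.IwasawaTheory.ClassicalMuVanishesCyclicAscentOddRat
import Literature.NumberTheory.EllipticCurves.ZpExtensionRestrictShift
import HarnessLib

/-!
# `μ_p = 0` for EVERY Galois number field of odd prime degree `p` and EVERY cyclotomic `ℤ_p`-extension — no proviso
# (Iwasawa 1956 + 1973; the first layer `ℚ_1` included)

`Proofs`-style file (theorems only; no definition, no named fact, no `sorry`) in topic `NumberTheory/IwasawaTheory`
(namespace `Literature.NumberTheory.IwasawaTheory`), written by the prover seat `bsd-potss-rkm` g46 (cell `bsd-potss`; library
pass, sequel of `ClassicalMuVanishesCyclicAscentOddRat.lean`).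

`ClassicalMuVanishesCyclicAscentOddRat.lean` proves `ClassicalMuVanishes (κ|_{K'})` for `K'/ℚ` Galois of odd prime degree `p`
under the proviso «`κ ∘ res_{K'/ℚ}` onto» (`K'` linearly disjoint from `ℚ_∞`, i.e. `K' ≠ ℚ_1`), which is needed even to FORM the
restricted tower `κ|_{K'}`.  This file removes the proviso and states the result for an arbitrary cyclotomic `ℤ_p`-extension
`κ'` of `K'`:

  **`classicalMuVanishes_of_isGalois_rat_of_finrank_eq_odd_prime`**: `p` odd, `K'/ℚ` Galois with `[K' : ℚ] = p`, `κ'` a cyclotomic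
  `ℤ_p`-extension of `K'` ⟹ `ClassicalMuVanishes κ'`.

The missing case is the first layer.  For a number field `K'` of PRIME degree `p` (no Galois or parity hypothesis) with
`κ ∘ res` NOT onto: the image `κ(res Γ_{K'}) = p^a ℤ_p` has `a ≥ 1` (shifted base change `p^a κ'' = κ ∘ res`,
`exists_zpExtension_shift`), so `res Γ_{K'} ≤ κ⁻¹(pℤ_p) = Gal(ℚ̄/ℚ_1)`; both have index `p` in `Γ_ℚ`, hence they are EQUAL
(§1 `range_absGaloisRestrict_eq_layerSubgroup_one_of_not_surjective`): the copy `e(K') ⊆ ℚ̄` is `ℚ_1`, in particular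
`e(K') ⊆ ℚ_m` for every `m ≥ 1` (§2).  The `n`-th layer of the shifted tower is the compositum `e(K')·ℚ_{n+a} = ℚ_{n+a}`
(`natCard_classGroup_layer_eq_of_layerSubgroup_eq`), whose class number is prime to `p` (Iwasawa 1956 over `ℚ`,
`classNumberPExp_rat_eq_zero`): so EVERY cyclotomic `ℤ_p`-extension of such a `K'` has `e_n = 0` for all `n`
(§3 `classNumberPExp_eq_zero_of_finrank_eq_prime_of_not_surjective`, all cyclotomic towers of a field sharing their layers,
`classNumberPExp_eq_of_isCyclotomic`) — a fortiori `μ = 0`.  §4 glues this with the onto case of the Rat file.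

* §1 `range_absGaloisRestrict_eq_layerSubgroup_one_of_not_surjective` — `[K' : ℚ] = p`, `κ ∘ res` not onto ⟹ `res Γ_{K'} = κ⁻¹(pℤ_p)`.
* §2 `fieldRange_absEmbedding_le_layer_of_not_surjective` — then `e(K') ≤ ℚ_m` for `m ≥ 1` (indeed `e(K') = ℚ_1`,
  `fieldRange_absEmbedding_eq_layer_one_of_not_surjective`).
* §3 `classNumberPExp_eq_zero_of_finrank_eq_prime_of_not_surjective` — then every cyclotomic `κ'` of `K'` has `e_n(κ') = 0`.
* §4 **`classicalMuVanishes_of_isGalois_rat_of_finrank_eq_odd_prime`** (the headline), and the `p ∤ [K' : ℚ]`-free packaging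
  `classicalMuVanishes_of_finrank_eq_prime_of_not_surjective` of §3 in growth form.

HONEST SCOPE.  Elementary Galois theory over the tree's `ZpExtension` currency; the arithmetic inputs are Iwasawa 1956 over `ℚ`
(`classNumberPExp_rat_eq_zero`) and Iwasawa 1973 Thm. 2 (the Rat file).  Cyclic fields of degree `p` are abelian, so the headline
is also an instance of Ferrero–Washington; the point is that the tree proves it with no `L`-function input.  Nothing about
elliptic curves or BSD is asserted; no K9/KT row of cell `bsd-potss` consumes this file (library pass; crux M 19196 unchanged).

References: [Iwasawa1973MuInvariants] Thm. 2 (ℓ odd); [Washington1997] §13.1 (`K_∞ L/L`, layers `L K_{n+a}`), Prop. 13.22,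
§13.3 Prop. 13.23; [NeukirchANT1999] Ch. IV §1 (closed subgroups and fixed fields).
-/

set_option autoImplicit false

noncomputable section

open scoped NumberField
open Field IntermediateField Module

namespace Literature.NumberTheory.IwasawaTheory

open Literature.NumberTheory.EllipticCurves Literature.NumberTheory.EllipticCurves.ZpExtension
  Literature.NumberTheory.GaloisRepresentations

variable {p : ℕ} [hp : Fact p.Prime]

/-! ## §1 A prime-degree field not linearly disjoint from `ℚ_∞` has `res Γ_{K'} = Gal(ℚ̄/ℚ_1)` -/

/-- The shift exponent of a NON-onto base change is positive: if `p^a · κ''(σ) = κ(res σ)` for all `σ` and `κ ∘ res` is not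
onto, then `a ≠ 0` (for `a = 0` the identity says `κ ∘ res = κ''`, which is onto). [cite: Washington1997, §13.1] -/
theorem shift_ne_zero_of_not_surjective {F : Type} [Field F] [NumberField F] (κ : ZpExtension F p)
    (M : Type) [Field M] [NumberField M] [Algebra F M] {a : ℕ} (κ'' : ZpExtension M p)
    (hs : ∀ σ : absoluteGaloisGroup M, (p : ℤ_[p]) ^ a * (κ'' σ).toAdd = (κ (absGaloisRestrict F M σ)).toAdd)
    (hK : ¬ Function.Surjective (κ.toContinuousMonoidHom.comp (absGaloisRestrict F M))) : a ≠ 0 := by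
  rintro rfl
  refine hK fun y => ?_
  obtain ⟨σ, hσ⟩ := κ''.surjective y
  refine ⟨σ, ?_⟩
  have h := hs σ
  rw [pow_zero, one_mul] at h
  have h' : κ (absGaloisRestrict F M σ) = κ'' σ := (Multiplicative.toAdd.injective h).symm
  exact h'.trans hσ

/-- **`res Γ_{K'} = κ⁻¹(pℤ_p)`** for a number field `K'` of prime degree `[K' : ℚ] = p` with `κ ∘ res_{K'/ℚ}` NOT onto (`κ` any
`ℤ_p`-extension of `ℚ`): the image `κ(res Γ_{K'}) = p^a ℤ_p` has `a ≥ 1`, so `res Γ_{K'} ≤ κ⁻¹(pℤ_p)`, and both subgroups have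
index `p` in `Γ_ℚ` (`nat_card_quotient_range_absGaloisRestrict`, `index_layerSubgroup`).  In words: `K'` IS the first layer `ℚ_1`.
[cite: Washington1997, §13.1] [cite: NeukirchANT1999, Ch. IV §1] -/
theorem range_absGaloisRestrict_eq_layerSubgroup_one_of_not_surjective (κ : ZpExtension ℚ p)
    (K' : Type) [Field K'] [NumberField K'] (hdeg : Module.finrank ℚ K' = p)
    (hK : ¬ Function.Surjective (κ.toContinuousMonoidHom.comp (absGaloisRestrict ℚ K'))) :
    (absGaloisRestrict ℚ K').range = κ.layerSubgroup 1 := by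
  obtain ⟨a, κ'', hs⟩ := exists_zpExtension_shift κ K'
  have ha : a ≠ 0 := shift_ne_zero_of_not_surjective κ K' κ'' hs hK
  -- `res Γ_{K'} ≤ κ⁻¹(pℤ_p)`
  have hle : (absGaloisRestrict ℚ K').range ≤ κ.layerSubgroup 1 := by
    rintro g ⟨σ, rfl⟩
    rw [mem_layerSubgroup, pow_one]
    change (p : ℤ_[p]) ∣ (κ (absGaloisRestrict ℚ K' σ)).toAdd
    rw [← hs σ]
    exact Dvd.dvd.mul_right (dvd_pow_self (p : ℤ_[p]) ha) _
  -- equal indices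
  have h1 : (absGaloisRestrict ℚ K').range.index = p := by
    rw [← hdeg]; exact nat_card_quotient_range_absGaloisRestrict ℚ K'
  have h2 : (κ.layerSubgroup 1).index = p := by rw [index_layerSubgroup, pow_one]
  have hrel := Subgroup.relIndex_mul_index hle
  rw [h1, h2] at hrel
  have hone : (absGaloisRestrict ℚ K').range.relIndex (κ.layerSubgroup 1) = 1 :=
    (Nat.mul_eq_right hp.out.ne_zero).mp hrel
  exact le_antisymm hle (Subgroup.relIndex_eq_one.mp hone)

/-! ## §2 Hence `e(K') ⊆ ℚ_m` for every `m ≥ 1` -/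

/-- **`e(K') ≤ ℚ_m` (`m ≥ 1`)** for `[K' : ℚ] = p` with `κ ∘ res` not onto, `e = absEmbedding ℚ K'` the tree's copy of `K'` in `ℚ̄`
(pointwise stabiliser `res Γ_{K'}`, `range_absGaloisRestrict_eq_fixingSubgroup_absEmbedding`): `Gal(ℚ̄/ℚ_m) ≤ Gal(ℚ̄/ℚ_1) = res Γ_{K'}`
fixes `e(K')` (Krull–Galois, `IntermediateField.le_iff_le`). [cite: Washington1997, §13.1] [cite: NeukirchANT1999, Ch. IV §1] -/
theorem fieldRange_absEmbedding_le_layer_of_not_surjective (κ : ZpExtension ℚ p)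
    (K' : Type) [Field K'] [NumberField K'] (hdeg : Module.finrank ℚ K' = p)
    (hK : ¬ Function.Surjective (κ.toContinuousMonoidHom.comp (absGaloisRestrict ℚ K'))) {m : ℕ} (hm : 1 ≤ m) :
    (absEmbedding ℚ K').fieldRange ≤ κ.layer m := by
  have heq := range_absGaloisRestrict_eq_layerSubgroup_one_of_not_surjective κ K' hdeg hK
  have hfix := range_absGaloisRestrict_eq_fixingSubgroup_absEmbedding ℚ K'
  change (absEmbedding ℚ K').fieldRange ≤ IntermediateField.fixedField _
  rw [IntermediateField.le_iff_le]
  intro g hg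
  rw [Subgroup.mem_map_equiv] at hg
  have h1 : (absoluteGaloisGroup.toAlgEquiv ℚ).symm g ∈ κ.layerSubgroup 1 := κ.layerSubgroup_antitone hm hg
  rw [← heq, hfix] at h1
  exact h1

/-- **`e(K') = ℚ_1`** under the same hypotheses (`≤` by the previous lemma; both have degree `p` over `ℚ`).
[cite: Washington1997, §13.1] -/
theorem fieldRange_absEmbedding_eq_layer_one_of_not_surjective (κ : ZpExtension ℚ p)
    (K' : Type) [Field K'] [NumberField K'] (hdeg : Module.finrank ℚ K' = p)
    (hK : ¬ Function.Surjective (κ.toContinuousMonoidHom.comp (absGaloisRestrict ℚ K'))) :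
    (absEmbedding ℚ K').fieldRange = κ.layer 1 := by
  haveI : FiniteDimensional ℚ ↥(κ.layer 1) := κ.finiteDimensional_layer_holds 1
  refine IntermediateField.eq_of_le_of_finrank_eq (fieldRange_absEmbedding_le_layer_of_not_surjective κ K' hdeg hK le_rfl) ?_
  rw [κ.finrank_layer_holds 1, pow_one, ← hdeg, ← IntermediateField.finrank_eq_finrank_subalgebra,
    AlgHom.fieldRange_toSubalgebra]
  exact (AlgEquiv.ofInjectiveField (absEmbedding ℚ K')).toLinearEquiv.finrank_eq.symm

/-! ## §3 Every cyclotomic `ℤ_p`-extension of such a `K'` has `e_n = 0` -/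

/-- **`e_n(κ') = 0` for every `n`** — `[K' : ℚ] = p` prime, `κ` a CYCLOTOMIC `ℤ_p`-extension of `ℚ` with `κ ∘ res_{K'/ℚ}` not onto
(`K'` is the first layer `ℚ_1`), `κ'` ANY cyclotomic `ℤ_p`-extension of `K'`: the shifted base change `κ''` (`p^a κ'' = κ ∘ res`,
`a ≥ 1`) is cyclotomic with `n`-th layer `e(K')·ℚ_{n+a} = ℚ_{n+a}` (§2), whose class number is prime to `p`
(`classNumberPExp_rat_eq_zero`, Iwasawa 1956 over `ℚ`); `κ'` has the same layers (`classNumberPExp_eq_of_isCyclotomic`).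
[cite: Washington1997, §13.1 and Prop. 13.22] -/
theorem classNumberPExp_eq_zero_of_finrank_eq_prime_of_not_surjective {κ : ZpExtension ℚ p} (hκ : κ.IsCyclotomic)
    (K' : Type) [Field K'] [NumberField K'] (hdeg : Module.finrank ℚ K' = p)
    (hK : ¬ Function.Surjective (κ.toContinuousMonoidHom.comp (absGaloisRestrict ℚ K')))
    (κ' : ZpExtension K' p) (hκ' : κ'.IsCyclotomic) (n : ℕ) : classNumberPExp κ' n = 0 := by
  obtain ⟨a, κ'', hs⟩ := exists_zpExtension_shift κ K'
  have ha : 1 ≤ a := Nat.one_le_iff_ne_zero.mpr (shift_ne_zero_of_not_surjective κ K' κ'' hs hK)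
  have hκ'' : κ''.IsCyclotomic := isCyclotomic_of_shift κ K' κ'' hs hκ
  rw [classNumberPExp_eq_of_isCyclotomic κ' κ'' hκ' hκ'' n, classNumberPExp_def,
    natCard_classGroup_layer_eq_of_layerSubgroup_eq κ K' κ'' (layerSubgroup_eq_comap_of_shift κ K' κ'' hs n)
      (absEmbedding ℚ K')]
  have hsup : (absEmbedding ℚ K').fieldRange ⊔ κ.layer (n + a) = κ.layer (n + a) :=
    sup_eq_right.mpr (fieldRange_absEmbedding_le_layer_of_not_surjective κ K' hdeg hK (le_add_left ha))
  have hcard : Nat.card (ClassGroup (𝓞 ↥((absEmbedding ℚ K').fieldRange ⊔ κ.layer (n + a)))) =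
      Nat.card (ClassGroup (𝓞 ↥(κ.layer (n + a)))) :=
    Nat.card_congr (ClassGroup.mulEquiv
      (NumberField.RingOfIntegers.mapRingEquiv (IntermediateField.equivOfEq hsup).toRingEquiv)).toEquiv
  rw [hcard]
  exact classNumberPExp_rat_eq_zero κ (n + a)

/-- Growth form of §3: **`ClassicalMuVanishes κ'`** for every cyclotomic `ℤ_p`-extension `κ'` of a number field `K'` of prime
degree `p` with `κ ∘ res` not onto (`K' = ℚ_1`; indeed `λ = μ = ν = 0`). No parity or Galois hypothesis.
[cite: Washington1997, §13.1 and Prop. 13.22] -/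
theorem classicalMuVanishes_of_finrank_eq_prime_of_not_surjective {κ : ZpExtension ℚ p} (hκ : κ.IsCyclotomic)
    (K' : Type) [Field K'] [NumberField K'] (hdeg : Module.finrank ℚ K' = p)
    (hK : ¬ Function.Surjective (κ.toContinuousMonoidHom.comp (absGaloisRestrict ℚ K')))
    (κ' : ZpExtension K' p) (hκ' : κ'.IsCyclotomic) : ClassicalMuVanishes κ' :=
  classicalMuVanishes_of_eventually_const κ' (c := 0) (n₀ := 0) fun n _ =>
    classNumberPExp_eq_zero_of_finrank_eq_prime_of_not_surjective hκ K' hdeg hK κ' hκ' n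

/-! ## §4 The headline: no proviso -/

/-- **Iwasawa's `μ_p = 0` for EVERY Galois number field of odd prime degree `p` and EVERY cyclotomic `ℤ_p`-extension.**
`p` odd, `K'/ℚ` Galois with `[K' : ℚ] = p` (a cyclic field of degree `p`), `κ'` a cyclotomic `ℤ_p`-extension of `K'`:
`ClassicalMuVanishes κ'`.  If `K'` is linearly disjoint from `ℚ_∞` this is the Rat file's
`classicalMuVanishes_restrict_rat_of_isGalois_of_finrank_eq_odd` (Iwasawa 1973 ascent from Iwasawa 1956 over `ℚ`) transported to
`κ'` (all cyclotomic towers of `K'` share their layers, `classicalMuVanishes_iff_of_isCyclotomic`); otherwise `K' = ℚ_1` and §3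
applies.  No Ferrero–Washington. [cite: Iwasawa1973MuInvariants, Thm. 2 (ℓ odd)] [cite: Washington1997, §13.3 Prop. 13.23 and Prop. 13.22] -/
theorem classicalMuVanishes_of_isGalois_rat_of_finrank_eq_odd_prime (hodd : p ≠ 2)
    (K' : Type) [Field K'] [NumberField K'] [IsGalois ℚ K'] (hdeg : Module.finrank ℚ K' = p)
    (κ' : ZpExtension K' p) (hκ' : κ'.IsCyclotomic) : ClassicalMuVanishes κ' := by
  obtain ⟨κ, hκ⟩ := ZpExtension.exists_isCyclotomic_holds ℚ p (GaloisRep.cyclotomicCharacter_range_infinite ℚ p)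
  by_cases hK : Function.Surjective (κ.toContinuousMonoidHom.comp (absGaloisRestrict ℚ K'))
  · exact (classicalMuVanishes_iff_of_isCyclotomic _ _ (isCyclotomic_restrict κ hκ K' hK) hκ').mp
      (classicalMuVanishes_restrict_rat_of_isGalois_of_finrank_eq_odd hodd hκ K' hdeg hK)
  · exact classicalMuVanishes_of_finrank_eq_prime_of_not_surjective hκ K' hdeg hK κ' hκ'

end Literature.NumberTheory.IwasawaTheory

end
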